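import Summits.HodgeConjecture.HodgeConjecture.Theorems.EndoscopicMiddleDegreeOrthogonalSplit
import Literature.AlgebraicGeometry.HodgeTheory.HardLefschetzHodgeRiemann
import Literature.AlgebraicGeometry.HodgeTheory.SupportedClassesHodgeConiveauProofs
import Literature.AlgebraicGeometry.HodgeTheory.ComplexConjugationHolds
import Literature.NumberTheory.Transcendental.DeRhamTheoremMultiplicative
import Literature.AlgebraicGeometry.HodgeTheory.HardLefschetzHodgeRiemannOfAnisotropy
import Literature.AlgebraicGeometry.HodgeTheory.HardLefschetzHodgeRiemannHolds
import Literature.AlgebraicGeometry.HodgeTheory.AlgebraicClassesHodgeTypeHolds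

/-!
# Route EndoscopicMiddleDegree · `OrthogonalSplit` (stmt-HodgeConjecture-14299) — the residue as Literature named facts

Companion of `EndoscopicMiddleDegreeOrthogonalSplit` (the conditional proof
`orthogonalSplit_of_kaehlerPackage`, 391 lines, at the file-size cap). That file vendored the Kähler
package of the hyperplane class as a Summits-side `def hardLefschetz_hodgeRiemann d X` (audit class
`vendored-fact`); the statement now exists as the Literature named fact
`Literature.AlgebraicGeometry.HodgeTheory.hardLefschetz_hodgeRiemann d X` (file
`HardLefschetzHodgeRiemann`, identical body, with its proved consequences
`….nonempty_hardLefschetzNFold`, `….hodgeClasses_cupPairing_nondegenerate`). Here: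

* `hardLefschetz_hodgeRiemann_iff` — the two renderings agree (definitional unfolding);
* `orthogonalSplit_of_facts` — `OrthogonalSplit` from the THREE LITERATURE FACTS that constitute the
  whole residue of the item: Grothendieck's coniveau inclusion
  `Grothendieck1969_supportedClasses_le_hodgeConiveau`, de Rham's theorem in multiplicative form
  `exists_deRhamIsoFamily 𝓘(ℝ, E)` for the finite-dimensional complex model spaces (in the tree the
  integration family `integrationDeRhamIsoFamily E` is constructed, natural and normalised; its
  MULTIPLICATIVITY, wedge ↦ cup, is what is missing), and `hardLefschetz_hodgeRiemann d Y` for all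
  smooth projective `Y`.

CLOSING RECIPE (for the prover resumed when the facts are discharged): with
`G_holds : Grothendieck1969_supportedClasses_le_hodgeConiveau`,
`dR_holds E : exists_deRhamIsoFamily 𝓘(ℝ, E)` and `K_holds d Y : hardLefschetz_hodgeRiemann d Y`,
append `theorem orthogonalSplit_proof : OrthogonalSplit := orthogonalSplit_of_facts G_holds (fun E _ _ _ ↦ dR_holds E) K_holds`
(`--workitem stmt-HodgeConjecture-14299`) and release the item `--by` it.
-/

noncomputable section

-- mandated namespace `Summit.HodgeConjecture.HodgeConjecture.Theorems` (single-problem summit: Problem =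
-- Summit) trips `linter.dupNamespace`; off tree-wide in the lakefile, restated for stand-alone elaboration.
set_option linter.dupNamespace false

open Literature.AlgebraicGeometry.Motives Literature.AlgebraicGeometry.HodgeTheory
open scoped Manifold

namespace Summit.HodgeConjecture.HodgeConjecture.Theorems

/-- The Summits-side rendering `hardLefschetz_hodgeRiemann d Y` of the Kähler package (vendored in
`EndoscopicMiddleDegreeOrthogonalSplit` before the fact existed under `Literature/`) IS the Literature
named fact `Literature.AlgebraicGeometry.HodgeTheory.hardLefschetz_hodgeRiemann d Y` (identical body):
discharging the Literature fact discharges this one. [cite: VoisinHodgeI2002, Thm. 6.25, Thm. 6.32 and Thm. 7.10] -/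
theorem hardLefschetz_hodgeRiemann_iff {d : ℕ} {Y : SchemeOver ℂ} :
    Summit.HodgeConjecture.HodgeConjecture.Theorems.hardLefschetz_hodgeRiemann d Y ↔
      Literature.AlgebraicGeometry.HodgeTheory.hardLefschetz_hodgeRiemann d Y :=
  Iff.rfl

/-- **`OrthogonalSplit` from the three Literature named facts** (route `EndoscopicMiddleDegree`, item
stmt-HodgeConjecture-14299): Grothendieck's coniveau inclusion (supported classes in degree
`2 · codim` are of type `(k,k)`: the theta world is spanned by rational Hodge classes), de Rham's
theorem in multiplicative form for the complex model spaces (cup product bigraded: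
`(m,m) ∪ (1,1) = (m+1,m+1)` for the Lefschetz summand), and the Kähler package of every smooth
projective `Y` (hard Lefschetz + Hodge–Riemann anisotropy: the cup form is non-isotropic on rational
combinations of theta classes, `hodgeClass_eq_zero_of_cup_orthogonal`), assembled by
`orthogonalSplit_of_kaehlerPackage`. [cite: VoisinHodgeI2002, Thm. 6.25, Thm. 6.32 and §7.1.2]
[cite: GrothendieckTopology1969, p. 299 (∗) and p. 300] [cite: WarnerGTM94, Thm. 5.36 / Thm. 5.45] -/
theorem orthogonalSplit_of_facts
    (hG : Grothendieck1969_supportedClasses_le_hodgeConiveau)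
    (hdR : ∀ (E : Type) [NormedAddCommGroup E] [NormedSpace ℂ E] [FiniteDimensional ℂ E],
      Literature.NumberTheory.Transcendental.exists_deRhamIsoFamily 𝓘(ℝ, E))
    (hK : ∀ (d : ℕ) (Y : SchemeOver ℂ),
      Literature.AlgebraicGeometry.HodgeTheory.hardLefschetz_hodgeRiemann d Y) :
    Theses.EndoscopicMiddleDegree.OrthogonalSplit :=
  orthogonalSplit_of_kaehlerPackage hG hdR fun d Y ↦ hardLefschetz_hodgeRiemann_iff.2 (hK d Y)

/-!
### The residue re-measured (2026-08-16, seat c1)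

Of the three named facts of `orthogonalSplit_of_facts`, de Rham's theorem in multiplicative form is
now a THEOREM of the tree (`Literature.NumberTheory.Transcendental.exists_deRhamIsoFamily_holds`, file
`DeRhamTheoremMultiplicative`), and so is the existence of Hodge models
(`nonempty_hodgeModel_holds`), whence Grothendieck's coniveau inclusion is
`Grothendieck1969_supportedClasses_le_hodgeConiveau_of_deligne hD _ _` from Deligne's Cor. 8.2.8
alone. Moreover the proof consumes the coniveau inclusion only in its PURE case `s = k`, degree
`2k` ("algebraic classes are Hodge classes": a class dying off a Zariski-closed subset of
codimension `≥ k`, in degree `2k`, is of type `(k, k)` — Voisin I Prop. 11.20 with Fulton 19.1.1),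
and the Kähler package only for the variety `X` carrying the datum (dimension `2(m+1) ∈ {4, 6}`).
The theorems below record this: `orthogonalSplit_of_pointwise` (the exact residue, per datum),
`orthogonalSplit_of_algebraicClasses_hodge` (two universally quantified hypotheses),
`orthogonalSplit_of_grothendieck` (named facts `Grothendieck1969_supportedClasses_le_hodgeConiveau` +
`hardLefschetz_hodgeRiemann`) and `orthogonalSplit_of_deligne` (named facts
`Deligne1974_ker_restrictCompl_eq_iSup_range_complexGysin` + `hardLefschetz_hodgeRiemann`).

CLOSING RECIPE (updated): `theorem orthogonalSplit_proof : OrthogonalSplit :=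
orthogonalSplit_of_grothendieck G_holds K_holds` (or `orthogonalSplit_of_deligne D_holds K_holds`),
`--workitem stmt-HodgeConjecture-14299`, release `--by Summit.HodgeConjecture.HodgeConjecture.Theorems.orthogonalSplit_proof`.
-/

open Literature.AlgebraicGeometry.ShimuraVarieties Literature.AlgebraicTopology.SingularHomology

/-- **`OrthogonalSplit` from its exact residue, datum by datum.** For every datum
`D : UnitaryBallQuotientDatum (2(m+1)) X`, `1 ≤ m ≤ 2`, assume (i) the algebraic (= supported in
codimension `≥ k`, degree `2k`) classes of `X` are of Hodge type `(k, k)` ("the class of an algebraic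
cycle is a Hodge class", the pure case of Grothendieck's coniveau inclusion) and (ii) the Kähler
package `hardLefschetz_hodgeRiemann (2(m+1)) X` of `X`. Then the orthogonal split holds: the proof of
`orthogonalSplit_of_kaehlerPackage` verbatim, with (i) in place of
`pullback_mem_hodgePQ_of_mem_supportedClasses` (types tested in the model `A` by
`hodgePQ_independent_of_hodgeModel_holds`) and the bigrading of the cup product supplied by the
theorem `exists_deRhamIsoFamily_holds`. [cite: VoisinHodgeI2002, Thm. 6.25, Thm. 6.32, §7.1.2 and Prop. 11.20]
[cite: BrosnanFangNiePearlstein2009, §6 (6.1)] -/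
theorem orthogonalSplit_of_pointwise
    (h : ∀ (m : ℕ) (X : SchemeOver ℂ) (_ : UnitaryBallQuotientDatum (2 * (m + 1)) X), 1 ≤ m → m ≤ 2 →
      (∀ (k : ℕ) (x : complexBetti X (2 * k)), x ∈ algebraicClasses X k →
        IsOfHodgeType (2 * (m + 1)) X (2 * k) k k x) ∧
      Literature.AlgebraicGeometry.HodgeTheory.hardLefschetz_hodgeRiemann (2 * (m + 1)) X) :
    Theses.EndoscopicMiddleDegree.OrthogonalSplit := by
  unfold Theses.EndoscopicMiddleDegree.OrthogonalSplit
  intro m X D hm₁ hm₂ c hcQ hcT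
  obtain ⟨hA, hK⟩ := h m X D hm₁ hm₂
  have hX : IsSmoothProjective (2 * (m + 1)) X := D.isSmoothProjective
  have hI : hodgePQ_independent_of_hodgeModel := hodgePQ_independent_of_hodgeModel_holds
  obtain ⟨A, hcA⟩ := hcT
  have hcup : CupPreservesHodgeType (2 * (m + 1)) X :=
    cupPreservesHodgeType_of_exists_deRhamIsoFamily hI hX A
      (Literature.NumberTheory.Transcendental.exists_deRhamIsoFamily_holds A.model)
  -- (i) read in the model `A`
  have hA' : ∀ (k : ℕ) (x : complexBetti X (2 * k)), x ∈ algebraicClasses X k →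
      A.pullback (2 * k) x ∈ A.hodgePQ (2 * k) k k := fun k x hx ↦
    (hI.isOfHodgeType_iff hX A).1 (hA k x hx)
  refine mem_sup_span_orthogonal (hardLefschetz_hodgeRiemann_iff.2 hK) hX A _ ?_ ?_ hcQ hcA
  · refine sup_le (sup_le ?_ ?_) ?_
    · refine iSup_le fun W ↦ iSup_le fun hW ↦ iSup_le fun hk ↦ ?_
      intro x hx
      have hcodim : ∀ z ∈ D.specialSubvariety W, ((m + 1 : ℕ) : ℕ∞) ≤ Order.coheight z := by
        intro z hz
        have := D.le_coheight_of_mem_specialSubvariety W hW z hz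
        rw [hk] at this
        exact_mod_cast this
      refine Submodule.span_mono ?_
        (span_isRationalClass_eq_top_of_isSmoothProjective.ker_restrictCompl_le_span
          span_isRationalClass_eq_top_of_isSmoothProjective_holds hX (D.specialSubvariety W)
          (2 * (m + 1)) hx)
      rintro y ⟨hyQ, hy0⟩
      have hy : y ∈ classesSupportedOn X (D.specialSubvariety W) (2 * (m + 1)) :=
        mem_classesSupportedOn_iff.2 hy0
      refine ⟨?_, hyQ, ⟨A, hA' (m + 1) y
        (classesSupportedOn_le_supportedClasses (D.isClosed_specialSubvariety W hW) hcodim _ hy)⟩⟩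
      exact Submodule.mem_sup_left (Submodule.mem_sup_left
        (Submodule.mem_iSup_of_mem W (Submodule.mem_iSup_of_mem hW (Submodule.mem_iSup_of_mem hk hy))))
    · refine iSup_le fun W ↦ iSup_le fun hW ↦ iSup_le fun hk ↦ iSup_le fun Z ↦ iSup_le fun hZ ↦
        iSup_le fun hZW ↦ iSup_le fun hcodim ↦ ?_
      intro x hx
      refine Submodule.span_mono ?_
        (span_isRationalClass_eq_top_of_isSmoothProjective.ker_restrictCompl_le_span
          span_isRationalClass_eq_top_of_isSmoothProjective_holds hX Z (2 * (m + 1)) hx)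
      rintro y ⟨hyQ, hy0⟩
      have hy : y ∈ classesSupportedOn X Z (2 * (m + 1)) := mem_classesSupportedOn_iff.2 hy0
      refine ⟨?_, hyQ, ⟨A, hA' (m + 1) y (classesSupportedOn_le_supportedClasses hZ hcodim _ hy)⟩⟩
      exact Submodule.mem_sup_left (Submodule.mem_sup_right
        (Submodule.mem_iSup_of_mem W (Submodule.mem_iSup_of_mem hW (Submodule.mem_iSup_of_mem hk
          (Submodule.mem_iSup_of_mem Z (Submodule.mem_iSup_of_mem hZ (Submodule.mem_iSup_of_mem hZW
            (Submodule.mem_iSup_of_mem hcodim hy))))))))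
    · refine Submodule.span_le.2 ?_
      rintro z ⟨a, haQ, haT, d, hd, rfl⟩
      have hd' := supportedClasses_le_span_isRationalClass hX (2 * 1) 1 hd
      have hz := Submodule.mem_map_of_mem (f := cupProduct (two_mul_add_two_mul m 1) a) hd'
      rw [Submodule.map_span] at hz
      refine Submodule.span_mono ?_ hz
      rintro _ ⟨d', ⟨hd'Q, hd'N⟩, rfl⟩
      refine ⟨?_, haQ.cup _ hd'Q, ?_⟩
      · exact Submodule.mem_sup_right (Submodule.subset_span ⟨a, haQ, haT, d', hd'N, rfl⟩)
      · exact hcup (two_mul_add_two_mul m 1) haT ⟨A, hA' 1 d' hd'N⟩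
  · intro b hbQ hbT d hd
    exact Submodule.mem_sup_right (Submodule.subset_span ⟨b, hbQ, hbT, d, hd, rfl⟩)

/-- **`OrthogonalSplit` from "algebraic classes are Hodge classes" and the Kähler package**, both
universally quantified: (i) for every smooth projective `Y` of dimension `d`, every class of
`Nᵏ H²ᵏ(Y(ℂ); ℂ)` is of type `(k, k)` (Voisin I Prop. 11.20: "the class of an algebraic cycle is a
Hodge class"; the pure case `s = k` of `Grothendieck1969_supportedClasses_le_hodgeConiveau`), and
(ii) `hardLefschetz_hodgeRiemann d Y` for all `(d, Y)` (Voisin I Thm. 6.25, Thm. 6.32, §7.1.2).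
[cite: VoisinHodgeI2002, Prop. 11.20, Thm. 6.25 and Thm. 6.32] -/
theorem orthogonalSplit_of_algebraicClasses_hodge
    (hA : ∀ ⦃d : ℕ⦄ ⦃Y : SchemeOver ℂ⦄, IsSmoothProjective d Y →
      ∀ (k : ℕ) (x : complexBetti Y (2 * k)), x ∈ algebraicClasses Y k → IsOfHodgeType d Y (2 * k) k k x)
    (hK : ∀ (d : ℕ) (Y : SchemeOver ℂ),
      Literature.AlgebraicGeometry.HodgeTheory.hardLefschetz_hodgeRiemann d Y) :
    Theses.EndoscopicMiddleDegree.OrthogonalSplit :=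
  orthogonalSplit_of_pointwise fun _ X D _ _ ↦ ⟨hA D.isSmoothProjective, hK _ X⟩

/-- **`OrthogonalSplit` from TWO named facts**: Grothendieck's coniveau inclusion
`Grothendieck1969_supportedClasses_le_hodgeConiveau` (used in its pure case: `N ᵏH²ᵏ` pulls back into
`H^{k,k}` of any Hodge model, which exists by `nonempty_hodgeModel_holds`) and the Kähler package
`hardLefschetz_hodgeRiemann d Y` for all `(d, Y)`; de Rham's theorem, the third hypothesis of
`orthogonalSplit_of_facts`, is discharged by `exists_deRhamIsoFamily_holds`.
[cite: GrothendieckTopology1969, p. 299 (∗) and p. 300] [cite: VoisinHodgeI2002, Thm. 6.25, Thm. 6.32 and §7.1.2] -/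
theorem orthogonalSplit_of_grothendieck
    (hG : Grothendieck1969_supportedClasses_le_hodgeConiveau)
    (hK : ∀ (d : ℕ) (Y : SchemeOver ℂ),
      Literature.AlgebraicGeometry.HodgeTheory.hardLefschetz_hodgeRiemann d Y) :
    Theses.EndoscopicMiddleDegree.OrthogonalSplit :=
  orthogonalSplit_of_algebraicClasses_hodge
    (fun _ _ hY _ _ hx ↦
      let ⟨A⟩ := nonempty_hodgeModel_holds hY
      ⟨A, pullback_mem_hodgePQ_of_mem_supportedClasses hG hY A hx⟩) hK

/-- **`OrthogonalSplit` from Deligne's Cor. 8.2.8 and the Kähler package** — the residue of item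
stmt-HodgeConjecture-14299 as of 2026-08-16: the named facts
`Deligne1974_ker_restrictCompl_eq_iSup_range_complexGysin` (Hodge III Cor. 8.2.8 on the summit
carriers, whence Grothendieck's coniveau inclusion by
`Grothendieck1969_supportedClasses_le_hodgeConiveau_of_deligne` fed the THEOREMS
`nonempty_hodgeModel_holds` and `exists_deRhamIsoFamily_holds`) and `hardLefschetz_hodgeRiemann d Y`
for all `(d, Y)`. [cite: DeligneHodgeIII1974, Cor. 8.2.8] [cite: GrothendieckTopology1969, p. 300]
[cite: VoisinHodgeI2002, Thm. 6.25, Thm. 6.32 and §7.1.2] -/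
theorem orthogonalSplit_of_deligne
    (hD : Deligne1974_ker_restrictCompl_eq_iSup_range_complexGysin)
    (hK : ∀ (d : ℕ) (Y : SchemeOver ℂ),
      Literature.AlgebraicGeometry.HodgeTheory.hardLefschetz_hodgeRiemann d Y) :
    Theses.EndoscopicMiddleDegree.OrthogonalSplit :=
  orthogonalSplit_of_grothendieck
    (Grothendieck1969_supportedClasses_le_hodgeConiveau_of_deligne hD
      (fun _ _ ↦ nonempty_hodgeModel_holds)
      fun E _ _ _ ↦ Literature.NumberTheory.Transcendental.exists_deRhamIsoFamily_holds E) hK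

/-!
### The Kähler package reduced to the Hodge–Riemann anisotropy (2026-08-16, seat c1, later the same day)

Hard Lefschetz for the hyperplane class is now a THEOREM of the tree
(`Literature.AlgebraicGeometry.HodgeTheory.nonempty_hardLefschetzNFold_holds`, file
`HardLefschetzNFoldHolds`; the hyperplane-type class is Kähler, rational up to a positive real,
supported on and moving along hyperplane sections), and the Kähler package
`hardLefschetz_hodgeRiemann d Y` follows from the sign-free Hodge–Riemann ANISOTROPY of the
hyperplane-type classes alone (`hardLefschetz_hodgeRiemann_of_anisotropy`, file `HardLefschetzHodgeRiemannOfAnisotropy`). The residue of the item is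
therefore: (i) algebraic classes are Hodge classes (pure case of Grothendieck's coniveau inclusion)
and (ii) that anisotropy (Voisin I Thm. 6.32 at `k = 2m`, `p = q = m`, for the restricted
Fubini–Study metric, transported to the cup product — hodge.S15 on the summit carrier).
-/

/-- **`OrthogonalSplit` from "algebraic classes are Hodge classes" and the Hodge–Riemann anisotropy of
the hyperplane-type classes** (everything else — hard Lefschetz, rationality and supports of the
hyperplane class, de Rham's theorem, Hodge models — being theorems of the tree): hypothesis (i) as in
`orthogonalSplit_of_algebraicClasses_hodge`; hypothesis (ii) verbatim the one of
`Literature.AlgebraicGeometry.HodgeTheory.hardLefschetz_hodgeRiemann_of_anisotropy`, for all smooth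
projective `(d, Y)`. [cite: VoisinHodgeI2002, Prop. 11.20, Thm. 6.25, Thm. 6.32 and Thm. 7.10] -/
theorem orthogonalSplit_of_algebraicClasses_hodge_of_anisotropy
    (hA : ∀ ⦃d : ℕ⦄ ⦃Y : SchemeOver ℂ⦄, IsSmoothProjective d Y →
      ∀ (k : ℕ) (x : complexBetti Y (2 * k)), x ∈ algebraicClasses Y k → IsOfHodgeType d Y (2 * k) k k x)
    (hHR : ∀ (d : ℕ) (Y : SchemeOver ℂ), IsSmoothProjective d Y → ∀ (A : HodgeModel d Y) (N : ℕ)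
      (ι : Y ⟶ projectiveSpace N ℂ) [AlgebraicGeometry.IsClosedImmersion ι.left]
      (hθ : Literature.AlgebraicGeometry.Motives.AnalytificationKaehler.fubiniStudyPullbackForm A.model ι
        A.toComplexPoints ∈ Literature.Geometry.Kaehler.closedSmoothForms 𝓘(ℝ, A.model) A.carrier ℝ 2)
      (H : complexBetti Y 2),
      A.pullback 2 H = ofRealClass A.carrier 2
        (Literature.NumberTheory.Transcendental.integrationDeRhamIsoFamily A.model A.carrier 2
          (Literature.Geometry.Kaehler.deRhamCohomology.mk
            ⟨Literature.AlgebraicGeometry.Motives.AnalytificationKaehler.fubiniStudyPullbackForm A.model ι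
              A.toComplexPoints, hθ⟩)) →
      ∀ (m s : ℕ) (_ : 2 * m + s = d) (y : complexBetti Y (2 * m)), IsRationalClass y →
        IsOfHodgeType d Y (2 * m) m m y →
        lefschetzPowTo H (s + 1) (2 * m) (2 * m + 2 * (s + 1)) rfl y = 0 → y ≠ 0 →
        cupProduct (show 2 * m + 2 * s + 2 * m = 2 * d by omega)
          (lefschetzPowTo H s (2 * m) (2 * m + 2 * s) rfl y) y ≠ 0) :
    Theses.EndoscopicMiddleDegree.OrthogonalSplit :=
  orthogonalSplit_of_algebraicClasses_hodge hA fun d Y ↦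
    Literature.AlgebraicGeometry.HodgeTheory.hardLefschetz_hodgeRiemann_of_anisotropy (hHR d Y)

/-!
### The Kähler package is a theorem (2026-08-16, seat c2)

`Literature.AlgebraicGeometry.HodgeTheory.hardLefschetz_hodgeRiemann_holds` (file
`HardLefschetzHodgeRiemannHolds`): the sign-free Hodge–Riemann anisotropy of the hyperplane-type
classes follows from Voisin I Thm. 6.32 on classes (`hodgeRiemann_primitiveClass`) and feeds
`hardLefschetz_hodgeRiemann_of_anisotropy`. Hence every `hK` / `hHR` hypothesis above is discharged,
and the residue of item stmt-HodgeConjecture-14299 is exactly ONE statement — "algebraic classes are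
Hodge classes" (the pure case `s = k`, degree `2k`, of Grothendieck's coniveau inclusion; Voisin I
Prop. 11.20) — in any of the three spellings below.

CLOSING RECIPE (updated): `theorem orthogonalSplit_proof : OrthogonalSplit :=
orthogonalSplit_of_algebraicClasses_isOfHodgeType h` (or `orthogonalSplit_of_grothendieck_fact G_holds`,
or `orthogonalSplit_of_deligne_fact D_holds`), `--workitem stmt-HodgeConjecture-14299`, release
`--by Summit.HodgeConjecture.HodgeConjecture.Theorems.orthogonalSplit_proof`.
-/

/-- **`OrthogonalSplit` from "algebraic classes are Hodge classes" ALONE**: for every smooth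
projective `Y` of dimension `d`, every class of `Nᵏ H²ᵏ(Y(ℂ); ℂ) = algebraicClasses Y k` is of Hodge
type `(k, k)` (Voisin I Prop. 11.20, "the class of an algebraic cycle is a Hodge class"; the pure case
of `Grothendieck1969_supportedClasses_le_hodgeConiveau`). The Kähler package is the theorem
`hardLefschetz_hodgeRiemann_holds`. [cite: VoisinHodgeI2002, Prop. 11.20, Thm. 6.25 and Thm. 6.32] -/
theorem orthogonalSplit_of_algebraicClasses_isOfHodgeType
    (hA : ∀ ⦃d : ℕ⦄ ⦃Y : SchemeOver ℂ⦄, IsSmoothProjective d Y →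
      ∀ (k : ℕ) (x : complexBetti Y (2 * k)), x ∈ algebraicClasses Y k → IsOfHodgeType d Y (2 * k) k k x) :
    Theses.EndoscopicMiddleDegree.OrthogonalSplit :=
  orthogonalSplit_of_algebraicClasses_hodge hA fun _ _ ↦
    Literature.AlgebraicGeometry.HodgeTheory.hardLefschetz_hodgeRiemann_holds

/-- **`OrthogonalSplit` from Grothendieck's coniveau inclusion ALONE** (named fact
`Grothendieck1969_supportedClasses_le_hodgeConiveau`, used in its pure case).
[cite: GrothendieckTopology1969, p. 299 (∗) and p. 300] [cite: VoisinHodgeI2002, Thm. 6.25 and Thm. 6.32] -/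
theorem orthogonalSplit_of_grothendieck_fact (hG : Grothendieck1969_supportedClasses_le_hodgeConiveau) :
    Theses.EndoscopicMiddleDegree.OrthogonalSplit :=
  orthogonalSplit_of_grothendieck hG fun _ _ ↦
    Literature.AlgebraicGeometry.HodgeTheory.hardLefschetz_hodgeRiemann_holds

/-- **`OrthogonalSplit` from Deligne's Cor. 8.2.8 ALONE** (named fact
`Deligne1974_ker_restrictCompl_eq_iSup_range_complexGysin`; its own residue in the tree is the child
`Deligne1974_ker_pullback_eq_ker_pullback_resolution`, Hodge III Prop. 8.2.7, file `GysinKernelSplit`).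
[cite: DeligneHodgeIII1974, Cor. 8.2.8] [cite: VoisinHodgeI2002, Thm. 6.25 and Thm. 6.32] -/
theorem orthogonalSplit_of_deligne_fact (hD : Deligne1974_ker_restrictCompl_eq_iSup_range_complexGysin) :
    Theses.EndoscopicMiddleDegree.OrthogonalSplit :=
  orthogonalSplit_of_deligne hD fun _ _ ↦
    Literature.AlgebraicGeometry.HodgeTheory.hardLefschetz_hodgeRiemann_holds

/-!
### The item closes (2026-08-16, seat c2)

Both residual facts are now theorems: the Kähler package (`hardLefschetz_hodgeRiemann_holds`) and
"algebraic classes are Hodge classes" (`isOfHodgeType_of_mem_algebraicClasses_of_isSmoothProjective`,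
file `AlgebraicClassesHodgeTypeHolds`: Voisin I Prop. 11.20 via purity, projective Hironaka, the Gysin
morphism and Wirtinger's non-vanishing of fundamental classes at a stalk-surjective point of a
resolution).
-/

/-- **`OrthogonalSplit` holds** (route `EndoscopicMiddleDegree`, item stmt-HodgeConjecture-14299): every
rational Hodge `(n,n)`-class of the `2n`-fold `X` carrying a unitary ball quotient datum, `n = m + 1`,
`m ∈ {1, 2}`, lies in the theta world `TW(D)` plus the span of the rational Hodge classes cup-orthogonal
to it — `orthogonalSplit_of_algebraicClasses_isOfHodgeType` fed with the theorem that algebraic classes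
are Hodge classes. Unconditional. [cite: VoisinHodgeI2002, Prop. 11.20, Thm. 6.25 and Thm. 6.32]
[cite: BrosnanFangNiePearlstein2009, §6 (6.1)] -/
theorem orthogonalSplit_proof : Theses.EndoscopicMiddleDegree.OrthogonalSplit :=
  orthogonalSplit_of_algebraicClasses_isOfHodgeType fun _ _ hY k _ hx ↦
    Literature.AlgebraicGeometry.HodgeTheory.isOfHodgeType_of_mem_algebraicClasses_of_isSmoothProjective
      hY k hx

end Summit.HodgeConjecture.HodgeConjecture.Theorems

end
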